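import Mathlib
import Summits.Ventures.PercRepro2.SwAllMarkStepClasses
import Summits.Ventures.PercRepro2.SwOutJunctionsGTyped

/-!
# THE GENERAL MARK STEP, VI: an independent set of junctions
(blind cell PercRepro2, night-4 g31, 2026-08-28; proofs/NIGHT4-G31.md §6c)

With the multi-junction theorem on the general doubly typed side (`gTypedSwAll_of_junctions`,
SwOutJunctionsGTyped) the general mark step settles g11's class B2 of the isolated graph:
**`swAll_markStep_of_junctions`** — an INDEPENDENT set `J` of junctions (no vertex of `{l, h, x}`;
each without loop; the neighbours of a junction other than `h` and `x` joined to `h`), every other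
vertex joined to `l` or hanging on the mark.  On the pattern `d` the junctions that are red
neighbours of the mark are exempt (`F`), and the others form the independent set `J ∖ R(d)` to
which the conditions on `h`'s clusters are blind.
-/

namespace Summit.Ventures.PercRepro2

namespace LocRows

open Hull

variable {V : Type*} {E : Type*} [Fintype E] [DecidableEq E]

open scoped Classical

variable {ends : E → Sym2 V} {x l h : V}

omit [Fintype E] [DecidableEq E] in
/-- An independent set avoiding `x` is independent in the isolated graph. -/
lemma indepSet_isolate {J : Set V} (hxJ : x ∉ J) (hind : IndepSet ends J) :
    IndepSet (isolate ends x) J := by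
  intro e a ha b hb hab
  by_cases hxe : x ∈ ends e
  · rw [isolate_apply_of_mem hxe, Sym2.eq_iff] at hab
    rcases hab with ⟨h1, h2⟩ | ⟨h1, h2⟩ <;> first | exact hxJ (h1 ▸ ha) | exact hxJ (h2 ▸ ha)
  · rw [isolate_apply_of_notMem hxe] at hab
    exact hind e a ha b hb hab

omit [Fintype E] [DecidableEq E] in
/-- A junction's adjacency hypothesis passes to the isolated graph (`u ≠ x`). -/
lemma hadj_isolate (hxh : x ≠ h) {u : V} (hux : u ≠ x)
    (hadj : ∀ e y, ends e = s(u, y) → y ≠ h → y ≠ x → ∃ e', ends e' = s(y, h)) :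
    ∀ e (he : u ∈ isolate ends x e), Sym2.Mem.other he ≠ h →
      ∃ e', isolate ends x e' = s(Sym2.Mem.other he, h) := by
  intro e he hoh
  have hxe : x ∉ ends e := by
    intro hxe
    rw [isolate_apply_of_mem hxe, Sym2.mem_iff] at he
    rcases he with h' | h' <;> exact hux h'
  have hends : ends e = s(u, Sym2.Mem.other he) := by
    rw [← isolate_apply_of_notMem hxe]
    exact (Sym2.other_spec he).symm
  have hox : Sym2.Mem.other he ≠ x := by
    intro h'
    apply hxe
    rw [hends, h']
    exact Sym2.mem_mk_right _ _
  obtain ⟨e', he'⟩ := hadj e _ hends hoh hox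
  exact ⟨e', isolate_eq_of_ends_eq hox hxh.symm he'⟩

/-- **THE GENERAL MARK STEP WITH AN INDEPENDENT SET OF JUNCTIONS** (g11's class B2 of the
isolated graph): junctions `J` not containing `l, h, x`, without loops, pairwise non-adjacent,
their neighbours other than `h` and `x` joined to `h`; every other vertex joined to `l` or hanging
on the mark. -/
theorem swAll_markStep_of_junctions (hlh : l ≠ h) (hloop : ∀ e, ends e ≠ s(h, h)) (hxl : x ≠ l)
    (hxh : x ≠ h) {J : Set V} (hlJ : l ∉ J) (hhJ : h ∉ J) (hxJ : x ∉ J) (hind : IndepSet ends J)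
    (hadj : ∀ u ∈ J, ∀ e y, ends e = s(u, y) → y ≠ h → y ≠ x → ∃ e', ends e' = s(y, h))
    (hout : ∀ y, y ≠ l → y ≠ h → y ≠ x → y ∉ J →
      (∃ e, ends e = s(y, l)) ∨ (∀ e, y ∈ ends e → x ∈ ends e)) : SwAll ends l h x := by
  refine swAll_of_gTyped_patterns hxl hxh fun d _ => ?_
  refine gTypedSwAll_of_junctions (F := fun y => y = x ∨ y ∈ openNbrs ends d x)
    (J := J \ openNbrs ends d x) hlh (isolate_hloop hxh hloop) (fun h' => hlJ h'.1)
    (fun h' => hhJ h'.1) (indepSet_isolate (fun h' => hxJ h'.1) (indepSet_mono Set.sdiff_subset hind))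
    (isUpperSet_markU d x) (isLowerSet_markD d x) (isLowerSet_markD'' d x) isUpperSet_univ ?_
    (fun T _ => Set.mem_univ _) (fun u hu h' => hxJ (h' ▸ hu.1)) (markF_exempt d) ?_ ?_
  · intro T hT y hy hyT
    rcases hyT with hyT | ⟨-, hyR⟩
    · exact hT y hy hyT
    · exact hyR hy
  · intro u hu
    exact hadj_isolate hxh (fun h' => hxJ (h' ▸ hu.1)) (hadj u hu.1)
  · intro y hyl hyh hyJ
    by_cases hyx : y = x
    · exact Or.inl (Or.inl hyx)
    by_cases hyR : y ∈ openNbrs ends d x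
    · exact Or.inl (Or.inr hyR)
    have hyJ' : y ∉ J := fun h' => hyJ ⟨h', hyR⟩
    rcases hout y hyl hyh hyx hyJ' with ⟨e, he⟩ | hiso
    · exact Or.inr (Or.inl ⟨e, isolate_eq_of_ends_eq hyx hxl.symm he⟩)
    · exact Or.inr (Or.inr (isolate_iso hyx hiso))

end LocRows

end Summit.Ventures.PercRepro2
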